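import Mathlib
import HarnessLib
import Summits.ValiantsHypothesis.ValiantsHypothesis.Theses.MonotoneRestoration
import Literature.Computability.AlgebraicComplexity.ArithCircuit
import Literature.Computability.AlgebraicComplexity.ArithCircuitProofs
import Literature.Computability.AlgebraicComplexity.MonotoneStructure
import Literature.Computability.AlgebraicComplexity.PermanentIrreducible
import Literature.ModelTheory.FiniteModelTheory.CkEquiv
import Summits.ValiantsHypothesis.ValiantsHypothesis.Theorems.MonotoneRestorationMonotoneRestorationQPCosetCount
import Summits.ValiantsHypothesis.ValiantsHypothesis.Theorems.MonotoneRestorationMonotoneRestorationQPSymmetricLB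
import Summits.ValiantsHypothesis.ValiantsHypothesis.Theorems.MonotoneRestorationMonotoneRestorationQPSupportSymmetrisation
import Summits.ValiantsHypothesis.ValiantsHypothesis.Theorems.MonotoneRestorationMonotoneRestorationQPSparseRegime
import Summits.ValiantsHypothesis.ValiantsHypothesis.Theorems.MonotoneRestorationMonotoneRestorationQPBeta
import Literature.Computability.AlgebraicComplexity.SymmetricArithCircuit
import Literature.Computability.AlgebraicComplexity.DawarWilsenach2025Proofs
import Literature.GroupTheory.PermutationGroups.SmallIndexSubgroups
import Summits.ValiantsHypothesis.ValiantsHypothesis.Theorems.MonotoneRestorationQP.Negative.LoadBearing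
import Summits.ValiantsHypothesis.ValiantsHypothesis.Theorems.MonotoneRestorationMonotoneRestorationQPPermSupportCount

/-! TTRL-lite variant V18918 of stmt-ValiantsHypothesis-15886 -/

-- `ValiantsHypothesis.ValiantsHypothesis`: the D-0017 layout repeats the problem name in the path.
set_option linter.dupNamespace false

namespace Summit.ValiantsHypothesis.ValiantsHypothesis.Theorems

open Summit.ValiantsHypothesis.ValiantsHypothesis.Theses.MonotoneRestoration
open Literature.Computability.AlgebraicComplexity

/-- **Two-factor kernel of support extension** (TTRL-lite variant V18918 of
`stub_mulGate_children_extend`). Over `ℝ≥0` there is no cancellation: if `p * q ≠ 0` and every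
monomial of `p * q` extends by a common shift `μ` to a monomial of `f`, then every monomial of `p`
extends by the common shift `m₀ + μ` to a monomial of `f`, where `m₀` is any monomial of the
(nonzero) cofactor `q`. -/
theorem stub_mulGate_children_extend_var18918 :
    ∀ (n : ℕ) (p q f : MvPolynomial (Fin n × Fin n) NNReal), p * q ≠ 0 →
      (∃ μ : (Fin n × Fin n) →₀ ℕ, ∀ m ∈ (p * q).support, m + μ ∈ f.support) →
      ∃ μ : (Fin n × Fin n) →₀ ℕ, ∀ m ∈ p.support, m + μ ∈ f.support := by
  intro n p q f hpq hext
  obtain ⟨μ, hμ⟩ := hext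
  have hq : q ≠ 0 := by
    intro hzero
    apply hpq
    rw [hzero, mul_zero]
  obtain ⟨m₀, hm₀⟩ := MvPolynomial.ne_zero_iff.mp hq
  have hm₀' : m₀ ∈ q.support := MvPolynomial.mem_support_iff.mpr hm₀
  refine ⟨m₀ + μ, ?_⟩
  intro m hm
  have hmm₀ : m + m₀ ∈ (p * q).support := add_mem_support_mul hm hm₀'
  have := hμ (m + m₀) hmm₀
  simpa only [add_assoc] using this

end Summit.ValiantsHypothesis.ValiantsHypothesis.Theorems
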